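import Summits.Ventures.PercRepro.StepiiCounterexample
import Summits.Ventures.PercRepro.CrossTwo

/-!
# The level-1 cross term is NEGATIVE on the gadget: a kernel-checked refutation of `CrossTwoNonpos`

`LEAD-C011-concavity.md` §10.6 records «`B(e) ≥ 0` for every free edge `e ≠ g`» (the middle
Bernstein coefficient of the Lemma-5 slack along a second edge `e`; `B(e) = −crossTwo` in
`CrossTwo.lean`) on every exact test.  It is false on the gadget graph `g0` of
`StepiiCounterexample.lean` (marks `0, 1, 2, 3`, hubs `4, 5`, `g = c–5` = edge `3`): along the edge
`e = a–5` (edge `2`, the gadget's `v–m₂`) at the rational weights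
`(b–c, d–4, ·, ·, c–4, a–b, b–4, 4–5) = (9/10, 1/10, ·, ·, 19/20, 9/10, 1/2, 3/10)` the cross term is
`crossTwo = 12369/32000000000 > 0`, i.e. `B(e) = −12369/32000000000 < 0` (p6 gen 4,
`mining/p6/attach/crosscheck2.out`, confirmed through the Bernstein identity at `t = 1/2, 1/3`).

The computation: the law `law4` at rational weights is the cast of a rational sum over the 256
configurations through the certified row table `rowT` (`rowD_eq_table`), and `crossTwo` is the cast
of the rational quadratic form of these laws; the rational value is then a kernel computation.
-/

namespace PercRepro

open Finset

/-! ### Rational weights, laws and the cross term -/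

/-- The weight of a configuration at rational edge probabilities. -/
def weightQ (q : Fin 8 → ℚ) (ω : Config (Fin 8)) : ℚ := ∏ e, if ω e then q e else 1 - q e

/-- The real weight at the cast of rational probabilities is the cast of the rational weight. -/
theorem weight_cast (q : Fin 8 → ℚ) (ω : Config (Fin 8)) :
    weight (fun i => (q i : ℝ)) ω = (weightQ q ω : ℝ) := by
  unfold weight weightQ
  push_cast
  refine Finset.prod_congr rfl fun e _ => ?_
  split_ifs <;> push_cast <;> rfl

/-- The law of `g0` at rational weights, through the certified row table. -/
def lawQ (q : Fin 8 → ℚ) (s : Fin 15) : ℚ :=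
  ∑ ω : Config (Fin 8), if rowT ω = s then weightQ q ω else 0

/-- `law4` of `g0` at the cast of rational weights is the cast of `lawQ`. -/
theorem law4_eq_lawQ (q : Fin 8 → ℚ) (s : Fin 15) :
    g0.law4 (fun i => (q i : ℝ)) 0 1 2 3 s = (lawQ q s : ℝ) := by
  unfold MultiGraph.law4 lawQ prob
  push_cast
  refine Finset.sum_congr rfl fun ω _ => ?_
  have key : ω ∈ g0.partitionEvent ![0, 1, 2, 3] (rgs4 s) ↔ rowT ω = s := by
    rw [← g0.row4_markedPartition_eq_iff]
    show row4 (g0.markedPartition ω m0) = s ↔ rowT ω = s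
    rw [rowD_eq, rowD_eq_table]
  by_cases h : rowT ω = s
  · rw [if_pos h, Set.indicator_of_mem (key.mpr h), weight_cast]
  · rw [if_neg h, Set.indicator_of_notMem (fun hm => h (key.mp hm)), Rat.cast_zero]

/-- Casting commutes with updating one weight. -/
theorem update_cast (q : Fin 8 → ℚ) (i : Fin 8) (x : ℚ) :
    Function.update (fun j => (q j : ℝ)) i (x : ℝ) = fun j => ((Function.update q i x j : ℚ) : ℝ) := by
  funext j
  by_cases h : j = i
  · subst h; simp
  · simp [Function.update_of_ne h]

/-- `Δ_g` at rational weights (rational). -/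
def deltaQ (q : Fin 8 → ℚ) (s : Fin 15) : ℚ :=
  lawQ (Function.update q 3 1) s - lawQ (Function.update q 3 0) s

/-- `Δ_g` of `g0` along `g = 3` at the cast of rational weights is the cast of `deltaQ`. -/
theorem deltaVec_eq_deltaQ (q : Fin 8 → ℚ) :
    g0.deltaVec (fun i => (q i : ℝ)) 3 0 1 2 3 = fun s => (deltaQ q s : ℝ) := by
  funext s
  unfold MultiGraph.deltaVec deltaQ
  have h1 : Function.update (fun j => (q j : ℝ)) 3 (1 : ℝ) =
      fun j => ((Function.update q 3 1 j : ℚ) : ℝ) := by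
    rw [← Rat.cast_one, update_cast]
  have h0 : Function.update (fun j => (q j : ℝ)) 3 (0 : ℝ) =
      fun j => ((Function.update q 3 0 j : ℚ) : ℝ) := by
    rw [← Rat.cast_zero, update_cast]
  rw [h1, h0, law4_eq_lawQ, law4_eq_lawQ]
  push_cast
  rfl

/-- The rational twin of `quadPlus`. -/
def quadPlusQ (u v : Fin 15 → ℚ) : ℚ :=
  (u 0 * v 14 + u 14 * v 0) / 2 -
    (∑ i : Fin 3, ∑ j : Fin 3, if i ≠ j then ![u 3, u 6, u 8] i * ![v 3, v 6, v 8] j else 0) / 2 -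
    (∑ i : Fin 3, ∑ j : Fin 3, if i ≠ j then
      ![u 3, u 6, u 8] i * ![v 4 + v 13, v 7 + v 12, v 11 + v 10] j +
        ![u 4 + u 13, u 7 + u 12, u 11 + u 10] j * ![v 3, v 6, v 8] i else 0) / 2

/-- `quadPlus` at casts is the cast of `quadPlusQ`. -/
theorem quadPlus_cast (u v : Fin 15 → ℚ) :
    quadPlus (fun s => (u s : ℝ)) (fun s => (v s : ℝ)) = (quadPlusQ u v : ℝ) := by
  simp only [quadPlus, quadPlusQ, crossOf, rank1Of, Fin.sum_univ_three]
  push_cast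
  simp

/-- The rational cross term along `e = 2` (the gadget's `v–m₂`) with `g = 3`. -/
def crossTwoQ (q : Fin 8 → ℚ) : ℚ :=
  quadPlusQ (deltaQ (Function.update q 2 0)) (deltaQ (Function.update q 2 1))

/-- `crossTwo` of `g0` at the cast of rational weights is the cast of `crossTwoQ`. -/
theorem crossTwo_eq_crossTwoQ (q : Fin 8 → ℚ) :
    g0.crossTwo (fun i => (q i : ℝ)) 3 2 0 1 2 3 = (crossTwoQ q : ℝ) := by
  unfold MultiGraph.crossTwo crossTwoQ
  have h0 : Function.update (fun j => (q j : ℝ)) 2 (0 : ℝ) =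
      fun j => ((Function.update q 2 0 j : ℚ) : ℝ) := by
    rw [← Rat.cast_zero, update_cast]
  have h1 : Function.update (fun j => (q j : ℝ)) 2 (1 : ℝ) =
      fun j => ((Function.update q 2 1 j : ℚ) : ℝ) := by
    rw [← Rat.cast_one, update_cast]
  rw [h0, h1, deltaVec_eq_deltaQ, deltaVec_eq_deltaQ, quadPlus_cast]

/-! ### The witness -/

/-- The witness palette on the eight edges of `g0` (`b–c, d–4, a–5, c–5, c–4, a–b, b–4, 4–5`):
the gadget's `(a–m₁, H–m₄, v–m₂, g, a–H, m₁–m₂, H–m₁, H–v) = (9/10, 1/10, ·, ·, 19/20, 9/10, 1/2, 3/10)`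
(the entries of `a–5` and `c–5` are set by the cross term and the slack, respectively). -/
def qW : Fin 8 → ℚ := ![9/10, 1/10, 0, 0, 19/20, 9/10, 1/2, 3/10]

/-- **The rational cross term at the witness is `12369/32000000000`** (kernel computation:
eight laws of 256 configurations each through the certified row table, then the quadratic form). -/
theorem crossTwoQ_qW : crossTwoQ qW = 12369 / 32000000000 := by
  decide +kernel

/-- The witness weights are probabilities. -/
theorem isProb_qW : IsProb fun i => (qW i : ℝ) := by
  intro i
  fin_cases i <;> norm_num [qW]

/-- **The level-1 cross term is positive on the gadget** (`B(e) < 0`). -/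
theorem crossTwo_g0_pos : 0 < g0.crossTwo (fun i => (qW i : ℝ)) 3 2 0 1 2 3 := by
  rw [crossTwo_eq_crossTwoQ, crossTwoQ_qW]
  norm_num

/-- **`CrossTwoNonpos` is false**: the whole-form single-edge induction of §10.6 has no valid
hypothesis; the live reduction is `EdgeQuadNonpos_of_CrossTwoDisc`. -/
theorem not_CrossTwoNonpos : ¬ CrossTwoNonpos := by
  intro h
  have := h g0 (fun i => (qW i : ℝ)) isProb_qW 0 1 2 3 3 2 (by decide)
  linarith [crossTwo_g0_pos]

end PercRepro
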